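import Summits.NavierStokesRegularity.NavierStokesRegularity.Theorems.ScenarioCensusForwardF1a
import HarnessLib

/-!
# Census row F19 «quasi-steady top» — part 1/2: the instrument `HasQuasiSteadyTop`, the criterion rows
# F-qs ⊇ F-frozen, F-∂t∞, F1qs, the structural statement, the residual; the one-point comparison tools

Re-homed for the scenario census (typer seat ns-census-typer-1 g5; lead g7 MINT INTENT F19 2026-08-28T16:06Z, ROW POLICY
15:11Z: ONE row F19 = Row_Fqs, in-row F19fr / F19∞ / F1qs; PORT ORDER 16:11Z) from ns-idea-3 g6's LINE 11 «quasi-steady-top»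
(`pub/ideators/ns-idea-3/lines/quasi-steady-top/line-quasi-steady-top.lean`, sha16 9bb49646717cc843, 434 l.; lean check rc 0,
0 sorry; ref g7 PRE-CHECK ✓ 16:07Z/16:13Z; critic idea-crit-3), in two files for the 400-line rule: this file (§1–§2 of the line +
`exists_sup_bound_at`, `norm_le_of_quasiSteady`) → `ScenarioCensusRowF19` (§3–§4: `rowFqs_of_rowF1a`, the closures, census keys).
Lean text verbatim in namespace `…Theorems.ScenarioCensus.QuasiSteadyTop` (the line's `…Cruxes.ScenarioCensusRowF1.QuasiSteadyTopLine`
re-homed; one bib key corrected).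

The instrument: `HasQuasiSteadyTop ν T δ u` — for some speed level `Λ`, at all times near `T` and all FAST points `Λ < |u(t,x)|`,
`‖∂ₜu(t,x)‖ ≤ δ √ν (T−t)^{-3/2}` (`∂ₜu = timeDerivWithin (Ico 0 T) u`, the classical solution's own time derivative).  Rows:
`Row_Fqs` (Clay frame, NO rate + quasi-steady top with `0 ≤ δ < 9 − 2√15` ⇒ extends), `Row_Ffrozen` (`δ = 0`), `Row_FdtSup`
(no top restriction), `Row_F1qs` (frame of `ScenarioCensus.Row_F1` verbatim + quasi-steady top), structural `TopUnsteadiness`,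
residual `TypeIQuasiSteadiness`.  Tools: `norm_le_barrier` (1-D fencing lemma), `exists_sup_bound_at` (Tao cover of a closed
sub-slab), `norm_le_of_quasiSteady` (the comparison bound).

No census value is asserted here (the lead books F19); NS regularity is NOT proved; `Row_F1` stays open; no summit statement
is proved by this file.
-/

noncomputable section

set_option linter.dupNamespace false

open MeasureTheory Set Function Filter TopologicalSpace Metric
open scoped Topology NNReal ENNReal

namespace Summit.NavierStokesRegularity.NavierStokesRegularity.Theorems.ScenarioCensus.QuasiSteadyTop

open Literature.Analysis Literature.Analysis.FluidPDE
open Summit.NavierStokesRegularity.NavierStokesRegularity.Theorems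

/-- `ℝ³`. -/
abbrev E3 := EuclideanSpace ℝ (Fin 3)

/-! ## §1 The instrument and the rows -/

/-- **Quasi-steady top with modulus `δ`**: for some speed level `Λ`, at all times `t` near `T` and all
FAST points `Λ < |u(t,x)|`, the time derivative is `δ`-subcritical for the blow-up clock:
`‖∂ₜu(t,x)‖ ≤ δ √ν / ((T−t)√(T−t))`.  (`∂ₜu = timeDerivWithin (Ico 0 T) u`, the derivative of the
classical solution within its own time set; no `rpow`, no junk at `t ≥ T` since only `t < T` near `T` is
read.) [folklore] -/
def HasQuasiSteadyTop (ν T δ : ℝ) (u : ℝ → E3 → E3) : Prop :=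
  ∃ Λ : ℝ, ∀ᶠ t in 𝓝[<] T, ∀ x, Λ < ‖u t x‖ →
    ‖timeDerivWithin (Ico 0 T) u t x‖ ≤ δ * Real.sqrt ν / ((T - t) * Real.sqrt (T - t))

/-- **Criterion row F-qs** (no rate assumed · no symmetry · Clay class · quasi-steady top): a classical
solution of the unforced system on `ℝ³ × [0,T)`, Leray–Hopf from its rapidly decaying datum, whose top is
quasi-steady with modulus `0 ≤ δ < 9 − 2√15`, extends smoothly past `T`.  PROVED (`rowFqs_holds`).
-/
def Row_Fqs : Prop :=
  ∀ (ν T δ : ℝ), 0 < ν → 0 < T → 0 ≤ δ → δ < 9 - 2 * Real.sqrt 15 →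
    ∀ (u : ℝ → E3 → E3) (p : ℝ → E3 → ℝ),
    IsClassicalNSSolutionOn (Ico 0 T) ν 0 u p → IsLerayHopfOn T ν 0 (u 0) u →
    HasRapidSpatialDecay (u 0) → HasQuasiSteadyTop ν T δ u → HasSmoothExtensionPast ν 0 u T

/-- **Sub-row F-frozen** (`δ = 0`): the top is FROZEN — `∂ₜu = 0` at every fast point near `T` — ⇒
extension.  PROVED (`rowFfrozen_holds`). -/
def Row_Ffrozen : Prop :=
  ∀ (ν T : ℝ), 0 < ν → 0 < T →
    ∀ (u : ℝ → E3 → E3) (p : ℝ → E3 → ℝ),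
    IsClassicalNSSolutionOn (Ico 0 T) ν 0 u p → IsLerayHopfOn T ν 0 (u 0) u →
    HasRapidSpatialDecay (u 0) →
    (∃ Λ : ℝ, ∀ᶠ t in 𝓝[<] T, ∀ x, Λ < ‖u t x‖ → timeDerivWithin (Ico 0 T) u t x = 0) →
    HasSmoothExtensionPast ν 0 u T

/-- **Sub-row F-∂t∞** (no top restriction): `‖∂ₜu(t,x)‖ ≤ δ√ν (T−t)^{-3/2}` for ALL `x` and all `t`
near `T`, `0 ≤ δ < 9 − 2√15` ⇒ extension (the weak-`L^{2/3}_t L^∞_x` small-constant endpoint for `∂ₜu`,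
outside the Banach `L^p_t L^q_x` scale of the printed `∂ₜu`/`∇p` criteria).  PROVED (`rowFdtSup_holds`).
-/
def Row_FdtSup : Prop :=
  ∀ (ν T δ : ℝ), 0 < ν → 0 < T → 0 ≤ δ → δ < 9 - 2 * Real.sqrt 15 →
    ∀ (u : ℝ → E3 → E3) (p : ℝ → E3 → ℝ),
    IsClassicalNSSolutionOn (Ico 0 T) ν 0 u p → IsLerayHopfOn T ν 0 (u 0) u →
    HasRapidSpatialDecay (u 0) →
    (∀ᶠ t in 𝓝[<] T, ∀ x,
      ‖timeDerivWithin (Ico 0 T) u t x‖ ≤ δ * Real.sqrt ν / ((T - t) * Real.sqrt (T - t))) →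
    HasSmoothExtensionPast ν 0 u T

/-- **Type-I member F1qs** (frame of `ScenarioCensus.Row_F1` verbatim + quasi-steady top): PROVED
(`rowF1qs_holds`; the rate hypothesis is not even used). -/
def Row_F1qs : Prop :=
  ∀ (ν T δ : ℝ), 0 < ν → 0 < T → 0 ≤ δ → δ < 9 - 2 * Real.sqrt 15 →
    ∀ (u : ℝ → E3 → E3) (p : ℝ → E3 → ℝ),
    IsClassicalNSSolutionOn (Ico 0 T) ν 0 u p → IsLerayHopfOn T ν 0 (u 0) u →
    HasRapidSpatialDecay (u 0) → IsTypeIBlowup u T → HasQuasiSteadyTop ν T δ u →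
    HasSmoothExtensionPast ν 0 u T

/-- **Structural statement «top unsteadiness»**: every Clay blow-up (maximal smooth solution, Leray–Hopf
from a rapidly decaying datum; any rate) has, for every `0 ≤ δ < 9 − 2√15`, every speed level `Λ` and every
`t₁ < T`, a fast point `(t,x)` with `t₁ < t < T`, `Λ < |u(t,x)|` and `‖∂ₜu(t,x)‖ > δ√ν (T−t)^{-3/2}`.
PROVED (`topUnsteadiness_holds`). -/
def TopUnsteadiness : Prop :=
  ∀ (ν T : ℝ), 0 < ν → 0 < T →
    ∀ (u : ℝ → E3 → E3) (p : ℝ → E3 → ℝ),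
    IsMaximalSmoothSolution ν 0 u p T → IsLerayHopfOn T ν 0 (u 0) u → HasRapidSpatialDecay (u 0) →
    ∀ (δ Λ t₁ : ℝ), 0 ≤ δ → δ < 9 - 2 * Real.sqrt 15 → t₁ < T →
      ∃ t ∈ Ioo t₁ T, ∃ x, Λ < ‖u t x‖ ∧
        δ * Real.sqrt ν / ((T - t) * Real.sqrt (T - t)) < ‖timeDerivWithin (Ico 0 T) u t x‖

/-- **Residual** (maximal frame): every Type-I Clay blow-up has a quasi-steady top with some modulus
`< 9 − 2√15`.  Typed so that `TypeIQuasiSteadiness ↔ Row_F1` (`typeIQuasiSteadiness_iff_rowF1`); DECLARED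
≡ row F1 — after `topUnsteadiness_holds` its content is «there is no Type-I Clay blow-up». -/
def TypeIQuasiSteadiness : Prop :=
  ∀ (ν T : ℝ), 0 < ν → 0 < T →
    ∀ (u : ℝ → E3 → E3) (p : ℝ → E3 → ℝ),
    IsMaximalSmoothSolution ν 0 u p T → IsLerayHopfOn T ν 0 (u 0) u →
    HasRapidSpatialDecay (u 0) → IsTypeIBlowup u T →
    ∃ δ : ℝ, 0 ≤ δ ∧ δ < 9 - 2 * Real.sqrt 15 ∧ HasQuasiSteadyTop ν T δ u

/-! ## §2 Real-variable tools -/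

/-- `0 < 9 − 2√15` (`60 < 81`). [folklore] -/
theorem deltaStar_pos : 0 < 9 - 2 * Real.sqrt 15 := by
  have h : Real.sqrt 15 < 9 / 2 := by
    rw [Real.sqrt_lt' (by norm_num)]; norm_num
  linarith

/-- The F1a arithmetic: for `0 ≤ δ < 9 − 2√15`, the rate constant `C = δ + 9 − 2√15` satisfies
`(9 + 2√15)/42 · C < 1` (since `(9+2√15)(9−2√15) = 21`). [folklore] -/
theorem kappa_mul_lt_one {δ : ℝ} (hδ : δ < 9 - 2 * Real.sqrt 15) :
    (9 + 2 * Real.sqrt 15) / 42 * (δ + 9 - 2 * Real.sqrt 15) < 1 := by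
  have h15 : Real.sqrt 15 * Real.sqrt 15 = 15 := Real.mul_self_sqrt (by norm_num)
  have hs : 0 ≤ Real.sqrt 15 := Real.sqrt_nonneg _
  have hpos : 0 < 9 + 2 * Real.sqrt 15 := by linarith
  have hgap : 0 < 9 - 2 * Real.sqrt 15 - δ := by linarith
  nlinarith [mul_pos hpos hgap]

/-- Derivative of the barrier profile `s ↦ (√(T−s))⁻¹` at `t < T`: `1 / (2 (T−t) √(T−t))`. [folklore] -/
theorem hasDerivAt_inv_sqrt_sub {T t : ℝ} (ht : t < T) :
    HasDerivAt (fun s => (Real.sqrt (T - s))⁻¹) (1 / (2 * ((T - t) * Real.sqrt (T - t)))) t := by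
  have hTt : 0 < T - t := sub_pos.2 ht
  have hsq : 0 < Real.sqrt (T - t) := Real.sqrt_pos.2 hTt
  have h1 : HasDerivAt (fun s => T - s) (-1) t := by
    simpa using (hasDerivAt_id t).const_sub T
  have h2 : HasDerivAt (fun s => Real.sqrt (T - s)) (-1 / (2 * Real.sqrt (T - t))) t :=
    h1.sqrt hTt.ne'
  have h3 := h2.inv hsq.ne'
  have h4 : -(-1 / (2 * Real.sqrt (T - t))) / Real.sqrt (T - t) ^ 2 =
      1 / (2 * ((T - t) * Real.sqrt (T - t))) := by
    rw [Real.sq_sqrt hTt.le]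
    field_simp
  exact h3.congr_deriv h4

/-- **The fencing step** (pure real analysis, one space point at a time).  Let `f : ℝ → F` be continuous on
`[a,b]` with right derivatives `f'` on `[a,b)`, `b < T`, and suppose `‖f' s‖ < δ' c / ((T−s)√(T−s))`
whenever `Λ < ‖f s‖` (`s ∈ [a,b)`).  If `‖f a‖ ≤ K` and `Λ < K`, then
`‖f s‖ ≤ K + 2δ'c((√(T−s))⁻¹ − (√(T−a))⁻¹)` on `[a,b]` (`0 ≤ δ' c`).  Proof: Mathlib's fencing lemma
`image_norm_le_of_norm_deriv_right_lt_deriv_boundary'` with the barrier `B`; where `‖f‖ = B ≥ K > Λ` the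
point is fast. [folklore] -/
theorem norm_le_barrier {F : Type*} [NormedAddCommGroup F] [NormedSpace ℝ F]
    {f : ℝ → F} {f' : ℝ → F} {a b T Λ K δc : ℝ} (hbT : b < T) (hδc : 0 ≤ δc) (hΛK : Λ < K)
    (hf : ContinuousOn f (Icc a b)) (hf' : ∀ s ∈ Ico a b, HasDerivWithinAt f (f' s) (Ici s) s)
    (hfast : ∀ s ∈ Ico a b, Λ < ‖f s‖ → ‖f' s‖ < δc / ((T - s) * Real.sqrt (T - s)))
    (ha : ‖f a‖ ≤ K) :
    ∀ s ∈ Icc a b, ‖f s‖ ≤ K + 2 * δc * ((Real.sqrt (T - s))⁻¹ - (Real.sqrt (T - a))⁻¹) := by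
  intro s hs
  by_cases hab : a ≤ b
  swap
  · exact absurd (hs.1.trans hs.2) hab
  set B : ℝ → ℝ := fun s => K + 2 * δc * ((Real.sqrt (T - s))⁻¹ - (Real.sqrt (T - a))⁻¹) with hB
  set B' : ℝ → ℝ := fun s => 2 * δc * (1 / (2 * ((T - s) * Real.sqrt (T - s)))) with hB'
  have hBd : ∀ s, s < T → HasDerivAt B (B' s) s := by
    intro s hsT
    have h := ((hasDerivAt_inv_sqrt_sub hsT).sub_const ((Real.sqrt (T - a))⁻¹)).const_mul (2 * δc)
    simpa [hB, hB'] using h.const_add K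
  have hBc : ContinuousOn B (Icc a b) := fun s hs' =>
    (hBd s (lt_of_le_of_lt hs'.2 hbT)).continuousAt.continuousWithinAt
  have hBd' : ∀ s ∈ Ico a b, HasDerivWithinAt B (B' s) (Ici s) s := fun s hs' =>
    (hBd s (hs'.2.trans hbT)).hasDerivWithinAt
  have hBa : ‖f a‖ ≤ B a := by simpa [hB] using ha
  -- the barrier stays above `K > Λ`
  have hBK : ∀ s ∈ Ico a b, K ≤ B s := by
    intro s hs'
    have hTs : 0 < T - s := by linarith [hs'.2]
    have hTa : 0 < T - a := by linarith [hs'.1, hs'.2]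
    have hmono : Real.sqrt (T - s) ≤ Real.sqrt (T - a) := Real.sqrt_le_sqrt (by linarith [hs'.1])
    have hinv : (Real.sqrt (T - a))⁻¹ ≤ (Real.sqrt (T - s))⁻¹ :=
      inv_anti₀ (Real.sqrt_pos.2 hTs) hmono
    have : 0 ≤ 2 * δc * ((Real.sqrt (T - s))⁻¹ - (Real.sqrt (T - a))⁻¹) :=
      mul_nonneg (by positivity) (sub_nonneg.2 hinv)
    simp only [hB]; linarith
  have hbound : ∀ s ∈ Ico a b, ‖f s‖ = B s → ‖f' s‖ < B' s := by
    intro s hs' hEq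
    have hfast' : Λ < ‖f s‖ := by rw [hEq]; exact lt_of_lt_of_le hΛK (hBK s hs')
    have h := hfast s hs' hfast'
    have hTs : 0 < T - s := by linarith [hs'.2]
    have hpos : 0 < (T - s) * Real.sqrt (T - s) := mul_pos hTs (Real.sqrt_pos.2 hTs)
    have hB's : B' s = δc / ((T - s) * Real.sqrt (T - s)) := by
      simp only [hB']; field_simp
    rw [hB's]; exact h
  exact image_norm_le_of_norm_deriv_right_lt_deriv_boundary' hf hf' hBa hBc hBd' hbound hs

/-! ## §3 The criterion row F-qs -/

/-- **Sup bound at one interior time** (Tao cover of the closed sub-slab `[0,t₁]`, Sobolev embedding).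
[cite: Tao2013Localisation, Cor. 11.1; AdamsFournier2003, Thm. 4.12] -/
theorem exists_sup_bound_at {ν T t₁ : ℝ} {u : ℝ → E3 → E3} {p : ℝ → E3 → ℝ} (hν : 0 < ν) (hT : 0 < T)
    (hsol : IsClassicalNSSolutionOn (Ico 0 T) ν 0 u p) (hLH : IsLerayHopfOn T ν 0 (u 0) u)
    (hdec : HasRapidSpatialDecay (u 0)) (ht₁ : t₁ ∈ Ioo 0 T) :
    ∃ M : ℝ, 0 ≤ M ∧ ∀ x, ‖u t₁ x‖ ≤ M := by
  obtain ⟨q, hsolc, hH, -, -⟩ := RungReynoldsOne.stub_taoCover hν hT hsol hLH hdec ht₁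
  obtain ⟨M, hM0, hM⟩ := exists_forall_norm_le_of_hasBoundedSobolevNormsOn hsolc hH
  exact ⟨M, hM0, fun x => hM t₁ ⟨ht₁.1.le, le_rfl⟩ x⟩

/-- **The comparison bound for the velocity**: under a strict quasi-steady bound with constant `δc ≥ 0`
at fast points on `[t₁,T)` (`0 < t₁`), and a sup bound `M` at time `t₁`, every later slice obeys
`‖u(t,x)‖ ≤ (M + Λ⁺ + 1) + 2δc((√(T−t))⁻¹ − (√(T−t₁))⁻¹)`. [folklore] -/
theorem norm_le_of_quasiSteady {ν T t₁ Λ M δc : ℝ} {u : ℝ → E3 → E3} {p : ℝ → E3 → ℝ}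
    (hsol : IsClassicalNSSolutionOn (Ico 0 T) ν 0 u p) (ht₁ : 0 < t₁) (hδc : 0 ≤ δc)
    (hM : ∀ x, ‖u t₁ x‖ ≤ M)
    (hqs : ∀ s ∈ Ico t₁ T, ∀ x, Λ < ‖u s x‖ →
      ‖timeDerivWithin (Ico 0 T) u s x‖ < δc / ((T - s) * Real.sqrt (T - s))) :
    ∀ t ∈ Ico t₁ T, ∀ x,
      ‖u t x‖ ≤ (M + max Λ 0 + 1) + 2 * δc * ((Real.sqrt (T - t))⁻¹ - (Real.sqrt (T - t₁))⁻¹) := by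
  intro t ht x
  have hK : Λ < M + max Λ 0 + 1 := by
    have h0 : 0 ≤ M := (norm_nonneg _).trans (hM x)
    linarith [le_max_left Λ 0]
  -- the time line through `x`
  have hcont : ContinuousOn (fun s => u s x) (Icc t₁ t) := by
    have hc := hsol.smooth_velocity.continuousOn
    have hmaps : MapsTo (fun s : ℝ => (s, x)) (Icc t₁ t) (Ico 0 T ×ˢ (univ : Set E3)) := fun s hs =>
      ⟨⟨ht₁.le.trans hs.1, lt_of_le_of_lt hs.2 ht.2⟩, mem_univ _⟩
    exact hc.comp (continuousOn_id.prodMk continuousOn_const) hmaps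
  have hder : ∀ s ∈ Ico t₁ t, HasDerivWithinAt (fun s => u s x)
      (timeDerivWithin (Ico 0 T) u s x) (Ici s) s := by
    intro s hs
    have hs0 : 0 < s := ht₁.trans_le hs.1
    have hsT : s < T := hs.2.trans ht.2
    have h := hsol.smooth_velocity.hasDerivWithinAt_timeDerivWithin (uniqueDiffOn_Ico 0 T) ⟨hs0.le, hsT⟩ x
    exact (h.hasDerivAt (Filter.mem_of_superset (Ioo_mem_nhds hs0 hsT) Ioo_subset_Ico_self)).hasDerivWithinAt
  have hfast : ∀ s ∈ Ico t₁ t, Λ < ‖u s x‖ →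
      ‖timeDerivWithin (Ico 0 T) u s x‖ < δc / ((T - s) * Real.sqrt (T - s)) := fun s hs hΛ =>
    hqs s ⟨hs.1, hs.2.trans ht.2⟩ x hΛ
  exact norm_le_barrier ht.2 hδc hK hcont hder hfast ((hM x).trans (by
    have h0 : 0 ≤ max Λ 0 := le_max_right _ _; linarith)) t ⟨ht.1, le_rfl⟩

end Summit.NavierStokesRegularity.NavierStokesRegularity.Theorems.ScenarioCensus.QuasiSteadyTop

end
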